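import Summits.FinalStateConjecture.FinalStateConjecture.Theorems.EIHFluxBalanceInertialRecessionRechartStepProfile
import Mathlib.Analysis.SpecialFunctions.Pow.Asymptotics
import Mathlib.Analysis.SpecialFunctions.Sqrt

/-!
# Route EIHFluxBalance — `InertialRecession`, re-charting: the BALL PROFILE of the clock-chart transfer
# (one lab-time profile `Rb` meeting every hole's coverage, slack, window, zone and reach constraints)

Helper file for the crux `stmt-FinalStateConjecture-10166`
(`Summit.FinalStateConjecture.FinalStateConjecture.Theses.EIHFluxBalance.InertialRecession`),
stub `stub_rechart` (the transfer P2 of line `sublinear-is-free-clean-window-charges`), part G2.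

`exists_ball_profile`: given, for each of `N` holes, a lab clock `θᵢ → ∞`, a dictionary tilt
`0 ≤ βᵢ` with the slack dichotomy `∀ n, ∀ᶠ t, βᵢ(t)·n ≤ (t − θᵢ t) + s₀ᵢ` (…RechartTiltEnvelope),
coverage thresholds `tcovᵢ : ℕ → ℝ`, bounds `Bᵢ ≥ 0`, window coefficients `wᵢ, w'ᵢ ≥ 0`, a certified-reach profile
`Rrᵢ → ∞` (monotone) and a floor `S`, there is ONE monotone step profile `Rb = Rn : ℝ → ℕ`, `Rb → ∞`,
`Rb(t)² ≤ t` (so `Rb/t → 0`), such that after a lab time `T`, for every hole: the coverage stage `Rn t`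
is valid (`tcovᵢ (Rn t) ≤ t`), `βᵢ(t) Rb(t) ≤ slackᵢ(t) + s₀ᵢ`, `wᵢ Rb(t) + w'ᵢ ≤ t/2`,
`S ≤ θᵢ t − s₀ᵢ − Bᵢ Rb(t)` and `Rb(t) ≤ Rrᵢ(θᵢ t − Bᵢ Rb(t))` — the inputs `hcov`/`hmesh` of
…RechartTransfer3 for the clock charts (`exists_step_profile_le` on the conjunction, which is antitone
in the stage and eventually true for each fixed stage). [folklore real analysis]
-/

noncomputable section

set_option linter.dupNamespace false

open Set Filter Topology

namespace Summit.FinalStateConjecture.FinalStateConjecture.Theorems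

/-- `Rb/t → 0` for a nonnegative profile with `Rb² ≤ t` eventually. [folklore] -/
theorem tendsto_div_of_sq_le {Rb : ℝ → ℝ} (h0 : ∀ t, 0 ≤ Rb t) {T : ℝ} (hsq : ∀ t, T ≤ t → Rb t ^ 2 ≤ t) :
    Tendsto (fun t ↦ Rb t / t) atTop (𝓝 0) := by
  have hup : Tendsto (fun t : ℝ ↦ (Real.sqrt t)⁻¹) atTop (𝓝 0) :=
    Real.tendsto_sqrt_atTop.inv_tendsto_atTop
  refine tendsto_of_tendsto_of_tendsto_of_le_of_le' tendsto_const_nhds hup ?_ ?_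
  · filter_upwards [eventually_gt_atTop 0] with t ht using div_nonneg (h0 t) ht.le
  · filter_upwards [eventually_ge_atTop T, eventually_gt_atTop 0] with t hT ht
    have hst : 0 < Real.sqrt t := Real.sqrt_pos.mpr ht
    have hle : Rb t ≤ Real.sqrt t := by
      rw [← Real.sqrt_sq (h0 t)]
      exact Real.sqrt_le_sqrt (hsq t hT)
    have hid : (Real.sqrt t)⁻¹ * t = Real.sqrt t := by
      rw [inv_mul_eq_div, div_eq_iff hst.ne', Real.mul_self_sqrt ht.le]
    rw [div_le_iff₀ ht, hid]
    exact hle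

/-- **The ball profile.** See the module docstring. [folklore] -/
theorem exists_ball_profile {N : ℕ} (θ β Rr : Fin N → ℝ → ℝ) (s₀ B w w' : Fin N → ℝ)
    (tcov : Fin N → ℕ → ℝ) (S : ℝ)
    (hθtop : ∀ i, Tendsto (θ i) atTop atTop) (hβ0 : ∀ i t, 0 ≤ β i t)
    (hB : ∀ i, 0 ≤ B i) (hw : ∀ i, 0 ≤ w i)
    (hev : ∀ i (n : ℕ), ∀ᶠ t in atTop, β i t * n ≤ (t - θ i t) + s₀ i)
    (hRrm : ∀ i, Monotone (Rr i)) (hRrtop : ∀ i, Tendsto (Rr i) atTop atTop) :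
    ∃ Rn : ℝ → ℕ, Monotone Rn ∧ Tendsto (fun t ↦ (Rn t : ℝ)) atTop atTop ∧
      Tendsto (fun t ↦ (Rn t : ℝ) / t) atTop (𝓝 0) ∧
      ∃ T : ℝ, ∀ t, T ≤ t → (Rn t : ℝ) ^ 2 ≤ t ∧ ∀ i, tcov i (Rn t) ≤ t ∧
        β i t * Rn t ≤ (t - θ i t) + s₀ i ∧ w i * Rn t + w' i ≤ t / 2 ∧
        S ≤ θ i t - s₀ i - B i * Rn t ∧ (Rn t : ℝ) ≤ Rr i (θ i t - B i * Rn t) := by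
  classical
  -- the stage property: coverage up to stage `n`, and the four inequalities at stage `n`
  set Q : ℕ → ℝ → Prop := fun n t ↦ (n : ℝ) ^ 2 ≤ t ∧ ∀ i, (∀ m, m ≤ n → tcov i m ≤ t) ∧
    β i t * n ≤ (t - θ i t) + s₀ i ∧ w i * n + w' i ≤ t / 2 ∧
    S ≤ θ i t - s₀ i - B i * n ∧ (n : ℝ) ≤ Rr i (θ i t - B i * n) with hQ
  have hanti : ∀ m n t, m ≤ n → Q n t → Q m t := by
    intro m n t hmn h
    have hmn' : (m : ℝ) ≤ n := by exact_mod_cast hmn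
    obtain ⟨hsq, hall⟩ := h
    refine ⟨le_trans (pow_le_pow_left₀ (Nat.cast_nonneg m) hmn' 2) hsq, fun i ↦ ?_⟩
    obtain ⟨hc, hs, hwin, hS, hR⟩ := hall i
    refine ⟨fun k hk ↦ hc k (hk.trans hmn), ?_, ?_, ?_, ?_⟩
    · exact le_trans (mul_le_mul_of_nonneg_left hmn' (hβ0 i t)) hs
    · nlinarith [hw i]
    · nlinarith [hB i]
    · exact hmn'.trans (hR.trans (hRrm i (by nlinarith [hB i])))
  have hstage : ∀ n : ℕ, ∃ T : ℝ, ∀ t, T ≤ t → Q n t := by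
    intro n
    -- each conjunct holds eventually; finitely many holes
    have h1 : ∀ᶠ t : ℝ in atTop, (n : ℝ) ^ 2 ≤ t := eventually_ge_atTop _
    have h2 : ∀ i, ∀ᶠ t : ℝ in atTop, (∀ m, m ≤ n → tcov i m ≤ t) ∧
        β i t * n ≤ (t - θ i t) + s₀ i ∧ w i * n + w' i ≤ t / 2 ∧
        S ≤ θ i t - s₀ i - B i * n ∧ (n : ℝ) ≤ Rr i (θ i t - B i * n) := by
      intro i
      have hc : ∀ᶠ t : ℝ in atTop, ∀ m, m ≤ n → tcov i m ≤ t := by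
        have : ∀ᶠ t : ℝ in atTop, ∀ m ∈ Finset.range (n + 1), tcov i m ≤ t :=
          (Finset.eventually_all (Finset.range (n + 1))).mpr fun m _ ↦ eventually_ge_atTop _
        exact this.mono fun t ht m hm ↦ ht m (Finset.mem_range.mpr (Nat.lt_succ_of_le hm))
      have hwin : ∀ᶠ t : ℝ in atTop, w i * n + w' i ≤ t / 2 := by
        filter_upwards [eventually_ge_atTop (2 * (w i * n + w' i))] with t ht; linarith
      have hS : ∀ᶠ t : ℝ in atTop, S ≤ θ i t - s₀ i - B i * n :=
        (hθtop i).eventually (eventually_ge_atTop (S + s₀ i + B i * n)) |>.mono fun t ht ↦ by linarith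
      have hR : ∀ᶠ t : ℝ in atTop, (n : ℝ) ≤ Rr i (θ i t - B i * n) := by
        have hcomp : Tendsto (fun t ↦ θ i t - B i * n) atTop atTop :=
          tendsto_atTop_add_const_right _ _ (hθtop i)
        exact ((hRrtop i).comp hcomp).eventually (eventually_ge_atTop _)
      filter_upwards [hc, hev i n, hwin, hS, hR] with t h1 h2 h3 h4 h5
      exact ⟨h1, h2, h3, h4, h5⟩
    have h2' : ∀ᶠ t : ℝ in atTop, ∀ i, (∀ m, m ≤ n → tcov i m ≤ t) ∧
        β i t * n ≤ (t - θ i t) + s₀ i ∧ w i * n + w' i ≤ t / 2 ∧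
        S ≤ θ i t - s₀ i - B i * n ∧ (n : ℝ) ≤ Rr i (θ i t - B i * n) := eventually_all.mpr h2
    obtain ⟨T, hT⟩ := eventually_atTop.mp (h1.and h2')
    exact ⟨T, fun t ht ↦ hT t ht⟩
  obtain ⟨Rn, hRm, hRtop, -, T, hT⟩ := exists_step_profile_le hstage hanti (fun t ↦ t) monotone_id tendsto_id
  have hsq : ∀ t, T ≤ t → (Rn t : ℝ) ^ 2 ≤ t := fun t ht ↦ (hT t ht).1
  refine ⟨Rn, hRm, hRtop, tendsto_div_of_sq_le (fun t ↦ Nat.cast_nonneg _) hsq, T, fun t ht ↦ ⟨hsq t ht, fun i ↦ ?_⟩⟩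
  obtain ⟨hc, hs, hwin, hS, hR⟩ := (hT t ht).2 i
  exact ⟨hc _ le_rfl, hs, hwin, hS, hR⟩

/-- Registered one-line form (stub `tendsto_div_of_sq_le_rechart` of the crux item) of
`tendsto_div_of_sq_le`. [folklore] -/
theorem tendsto_div_of_sq_le_rechart : open Filter Topology in ∀ {Rb : ℝ → ℝ}, (∀ t, 0 ≤ Rb t) → ∀ {T : ℝ}, (∀ t, T ≤ t → Rb t ^ 2 ≤ t) → Tendsto (fun t ↦ Rb t / t) atTop (𝓝 0) :=
  fun h0 _ hsq ↦ tendsto_div_of_sq_le h0 hsq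

end Summit.FinalStateConjecture.FinalStateConjecture.Theorems
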